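import Summits.QuantumFields.YangMills.Theorems.BalabanUVNodesN16CentreConventionTransfer
import HarnessLib

/-!
# YM-DAG node N16 (NE3), the located averaging pin (42) ↔ (0.4) — part 15: EXISTENCE TRANSFER, and THE DEPTH-ONE NON-ABELIAN LINK: on the small-field class at
# depth 1 the centre-convention torus (42) `cstep` and the tree's (43) have gauge-equivalent constrained minimisers at the same datum

Cell `pub-ymgap`, width seat `pub-ymgap-dag-n16-w3` (director-ym №197 ∕ HUMAN RULING D-0149), generation 6; part 15 of the W1b lineage (part 12 p612224, part 13
p614236, part 14 p616704).  `--kind proof --supports stmt-QuantumFields-20544 --as helper` (K3⁷; count-neutral; 0 `def`).  `bears_on: R4∕N16`.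

THE POINT.
 * §1 `exists_isMinimiserS_iff_of_schemeGaugeEquiv`: under part 14's `SchemeGaugeEquiv` (block-lift covariance + pointwise coarse-gauge equivalence) on a
   gauge-invariant class, EXISTENCE of a constrained minimiser at a datum transfers between the two schemes (the `∃ U, IsMinimiser …` shape of the slot key (T8),
   n16-w1 g5 `LOCATED-N16-SLOT-KEY.md`); `exists_isMinimiser_iff_of_exactGaugeDefect` (part 12's criterion: scheme vs (43)).
 * §2 `guard_of_smallField`: a `U(N)`-valued configuration with PLAQUETTES within `α₀` of `1`, `512(d+1)(d+4)L²α₀ ≤ 1`, satisfies the guard of row NE7's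
   guarded (42) `QLaTorusB7Averaging.gb` at every bond (b07's `B7Prop2Explicit.norm_Wcx_sub_one_le`, p. 25: `|V(Γ_{c,x})V(c)⁻¹ − 1| ≤ 16(d+1)(d+4)L²α₀ ≤ 1∕32`) —
   GAUGE-INVARIANT smallness (contrast `QLaTorusIterate.guard_of_small`, bond smallness); hence `gbstep_eq_step42_of_smallField` and, at depth 1 on the small-field class
   `sfClass d L T ε 1` (plaquette radius `ε∕L²`) with `512(d+1)(d+4)ε ≤ 1`: ★ `schemeGaugeEquiv_step42_cstep_one` — (43) and the centre-convention `cstep` are pointwise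
   coarse-gauge equivalent (part 14's frame transports + the guard), so ★★ `exists_isMinimiser_gaugeAct_of_isMinimiserS_cstep_one` ∕ ★★
   `exists_isMinimiserS_cstep_gaugeAct_of_isMinimiser_one`: depth-1 minimisers of the `cstep`-constrained problem and of the tree's (43)-constrained problem
   (`MinimalActionSandwich.IsMinimiser`, via g0's `isMinimiserS_step42_iff`) AT THE SAME DATUM correspond under unitary `(T·L)`-periodic gauges; ★ `exists_isMinimiser_one_iff_cstep`.
   Deeper levels need the guard along the averaging orbit (the tree's `LevelSmall` ∕ `cavgIter_eq_avgIter` road) and are NOT claimed.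
 * §3 (v1.1, APPEND-ONLY; §1–§2 byte-identical to v1.0 p618456) `forall_isMinimiserS_iff_of_schemeGaugeEquiv` ∕ `forall_isMinimiser_iff_of_exactGaugeDefect`: EVERY
   property `Q` of configurations that is invariant under unitary `(N·L^k)`-periodic gauges holds for all `s₂`-constrained minimisers at the data of `dom` iff it
   holds for all `s₁`-constrained ones (resp. all (43)-constrained ones) — the general form of which g0's `LeafH3supS` (`Q = RegularSup`, part 14
   `leafH3supS_iff_of_schemeGaugeEquiv`) is the instance; usable for any gauge-invariant leaf reading (e.g. slot-key shapes) once its invariance is supplied.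

HONEST FRAMING.  [folklore] bookkeeping BY NAME over parts 12∕14, g0's `N16AveragingPin`, `QLaTorusB7Averaging`, `B7Prop2Explicit.norm_Wcx_sub_one_le`,
`AveragingDeficitTransport.mem_U1_of_unitary`, `NE3ResidualSliceRep.mem_sfClass_gaugeAct`; 0 `def`, 0 `sorry`; no minimiser is constructed (existence is
TRANSFERRED, never produced); nothing of [Balaban1985Averaging] ∕ [Balaban1987RG1] asserted; K3⁷ stubs NOT touched; N16 ∕ NE3 NOT discharged; count-neutral (typed
28∕28 · discharged 5∕27 work-bound, A 5∕28 — unmoved).  One finite four-torus programme at fixed `ε` — the Yang–Mills mass gap (Clay) is NOT proved by any of this; R4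
closes the conditional finite-𝕋⁴ rung `BalabanLadder.UV` only; nothing continuum ∕ ℝ⁴ ∕ OS.
-/

set_option autoImplicit false

open scoped BigOperators Matrix Matrix.Norms.L2Operator
open NormedSpace

namespace Summit.QuantumFields.YangMills.BalabanUVNodes.N16CentreConventionDepthOne

open Literature.MathematicalPhysics.QuantumFieldTheory.Balaban1983to89
open B7Prop1Explicit B7Prop2Explicit
open T4AveragingDeficitWall (IsUnitaryCfg SmallField)
open T4AveragingDeficitWallBoundary (IsPeriodicCfg)
open Summit.QuantumFields.BalabanUV.T4Continuum
open MinimalActionSandwich (IsMinimiser)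
open MinimalActionRate (sfClass)
open NE3EnergyShapes (IsUnitarySite IsPeriodicSite)
open NE3ResidualSliceRep (mem_sfClass_gaugeAct)
open AveragingDeficitTransport (mem_U1_of_unitary)
open Summit.QuantumFields.YangMills.BalabanUVNodes.N16AveragingPin (avgIterS step42 avgIterS_step42 avgIterS_const IsMinimiserS isMinimiserS_step42_iff)
open Summit.QuantumFields.YangMills.BalabanUVNodes.N16AveragingTransferOfGaugeDefect
  (uLev_blockLift ExactGaugeDefect exists_isMinimiser_gaugeAct_of_isMinimiserS exists_isMinimiserS_gaugeAct_of_isMinimiser)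
open Summit.QuantumFields.YangMills.BalabanUVNodes.N16CentreConventionTransfer
  (SchemeGaugeEquiv exists_isMinimiserS_gaugeAct_of_isMinimiserS schemeGaugeEquiv_cstep gb_eq_bavg_of_guard)
open Summit.QuantumFields.BalabanUV.T4Continuum.Spine.NE7.TorusB7 (Mat Guard gb cstep)

noncomputable section

/-! ## §1 Existence of constrained minimisers transfers between gauge-equivalent schemes -/

section Existence

variable {d : ℕ} {n : Type*} [Fintype n] [DecidableEq n]
variable {s s₁ s₂ : ℕ → (Site d → Fin d → (Matrix n n ℂ)ˣ) → (Site d → Fin d → (Matrix n n ℂ)ˣ)}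
  {𝒞 : ℕ → Set (Site d → Fin d → (Matrix n n ℂ)ˣ)} {L N k : ℕ}

/-- **EXISTENCE OF A CONSTRAINED MINIMISER AT A DATUM TRANSFERS** between two schemes that are pointwise coarse-gauge equivalent with block-lift covariance on a
gauge-invariant class (part 14's transfer in both directions; the minimisers differ by a unitary `(N·L^k)`-periodic gauge). [folklore] -/
theorem exists_isMinimiserS_iff_of_schemeGaugeEquiv (hL : 1 ≤ L)
    (hC : ∀ (u : Site d → (Matrix n n ℂ)ˣ) (U : Site d → Fin d → (Matrix n n ℂ)ˣ), IsUnitarySite u →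
      IsPeriodicSite u ((N * L ^ k : ℕ) : ℤ) → U ∈ 𝒞 k → gaugeAct u U ∈ 𝒞 k)
    (hE : SchemeGaugeEquiv d s₁ s₂ L N k (𝒞 k)) (V : Site d → Fin d → (Matrix n n ℂ)ˣ) :
    (∃ U, IsMinimiserS d s₂ 𝒞 L N k V U) ↔ ∃ U, IsMinimiserS d s₁ 𝒞 L N k V U := by
  constructor
  · rintro ⟨U, hU⟩
    obtain ⟨u, -, -, h⟩ := exists_isMinimiserS_gaugeAct_of_isMinimiserS hL hC hE hU
    exact ⟨_, h⟩
  · rintro ⟨U, hU⟩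
    obtain ⟨u, -, -, h⟩ := exists_isMinimiserS_gaugeAct_of_isMinimiserS hL hC hE.symm hU
    exact ⟨_, h⟩

/-- The same for part 12's criterion against (43): `∃ U, IsMinimiserS s … V U` iff `∃ U, IsMinimiser … V U` (g0's (43)-dictionary `isMinimiserS_step42_iff`). [folklore] -/
theorem exists_isMinimiser_iff_of_exactGaugeDefect (hL : 1 ≤ L)
    (hC : ∀ (u : Site d → (Matrix n n ℂ)ˣ) (U : Site d → Fin d → (Matrix n n ℂ)ˣ), IsUnitarySite u →
      IsPeriodicSite u ((N * L ^ k : ℕ) : ℤ) → U ∈ 𝒞 k → gaugeAct u U ∈ 𝒞 k)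
    (hE : ExactGaugeDefect d s L N k (𝒞 k)) (V : Site d → Fin d → (Matrix n n ℂ)ˣ) :
    (∃ U, IsMinimiserS d s 𝒞 L N k V U) ↔ ∃ U, IsMinimiser d 𝒞 L N k V U := by
  constructor
  · rintro ⟨U, hU⟩
    obtain ⟨u, -, -, h⟩ := exists_isMinimiser_gaugeAct_of_isMinimiserS hL hC hE hU
    exact ⟨_, h⟩
  · rintro ⟨U, hU⟩
    obtain ⟨u, -, -, h⟩ := exists_isMinimiserS_gaugeAct_of_isMinimiser hL hC hE hU
    exact ⟨_, h⟩

end Existence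

/-! ## §2 The guard from gauge-invariant smallness; the depth-one link `cstep` ↔ (43) -/

section DepthOne

variable {P : Params} {N : ℕ} [NeZero N]

/-- **THE GUARD FROM PLAQUETTE SMALLNESS** (gauge invariant): a `U(N)`-valued configuration whose plaquette variables are within `α₀` of `1`,
`512(d+1)(d+4)L²α₀ ≤ 1`, satisfies `Guard` at every bond — b07's `norm_Wcx_sub_one_le` (p. 25): `|V(Γ_{c,x})V(c)⁻¹ − 1| ≤ 16(d+1)(d+4)L²α₀ ≤ 1∕32 ≤ 1∕4`.
[cite: Balaban1985Averaging, p.25 (displays before (47))] -/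
theorem guard_of_smallField {W : Site P.d → Fin P.d → (Mat N)ˣ} (hW : IsUnitaryCfg W) {α₀ : ℝ} (hα₀ : 0 ≤ α₀)
    (hsmall : 512 * (P.d + 1) * (P.d + 4) * (P.L : ℝ) ^ 2 * α₀ ≤ 1) (hS : SmallField W α₀) (q : Site P.d) (κ : Fin P.d) :
    Guard P N W q κ := by
  haveI : Nonempty (Fin N) := ⟨0⟩
  have hW1 : ∀ x κ, W x κ ∈ U1 (Mat N) := fun x κ => mem_U1_of_unitary (hW x κ)
  intro r
  have h := norm_Wcx_sub_one_le P.L P.hL.2.le W hW1 hα₀ hsmall hS q κ r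
  have h32 : 2 * (8 * (P.d + 1) * (P.d + 4) * (P.L : ℝ) ^ 2 * α₀) ≤ 1 / 32 := by linarith
  linarith

/-- Hence on such a configuration the corner-convention guarded step IS `step42` (the tree's (42)∕(43) step): `rescale L (gb W) = step42 L W`. [folklore] -/
theorem gbstep_eq_step42_of_smallField {W : Site P.d → Fin P.d → (Mat N)ˣ} (hW : IsUnitaryCfg W) {α₀ : ℝ} (hα₀ : 0 ≤ α₀)
    (hsmall : 512 * (P.d + 1) * (P.d + 4) * (P.L : ℝ) ^ 2 * α₀ ≤ 1) (hS : SmallField W α₀) :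
    rescale P.L (gb P N W) = step42 P.L W := by
  funext z κ
  rw [rescale_apply, gb_eq_bavg_of_guard P N (guard_of_smallField hW hα₀ hsmall hS _ _)]
  rfl

/-- The small-field class at depth 1 (plaquette radius `ε∕L²`) meets the guard's smallness when `512(d+1)(d+4)·ε ≤ 1`. [folklore] -/
theorem smallness_one {ε : ℝ} (hε : 512 * (P.d + 1) * (P.d + 4) * ε ≤ 1) :
    512 * (P.d + 1) * (P.d + 4) * (P.L : ℝ) ^ 2 * (ε / ((P.L : ℝ) ^ 1) ^ 2) ≤ 1 := by
  have hL : (0 : ℝ) < (P.L : ℝ) := by have := P.hL.2; positivity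
  have key : 512 * (P.d + 1) * (P.d + 4) * (P.L : ℝ) ^ 2 * (ε / ((P.L : ℝ) ^ 1) ^ 2) = 512 * (P.d + 1) * (P.d + 4) * ε := by
    field_simp
  rw [key]
  exact hε

/-- **★ AT DEPTH 1, ON THE SMALL-FIELD CLASS, (43) AND THE CENTRE-CONVENTION `cstep` ARE POINTWISE COARSE-GAUGE EQUIVALENT** (part 14's frame-transport equivalence
`cstep ≃ rescale ∘ gb` composed with §2's guard `rescale ∘ gb = step42`): `SchemeGaugeEquiv P.d (step42) (cstep) P.L T 1 (sfClass P.d P.L T ε 1)` for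
`512(d+1)(d+4)ε ≤ 1`, `0 ≤ ε`. [folklore] -/
theorem schemeGaugeEquiv_step42_cstep_one (T : ℕ) {ε : ℝ} (hε0 : 0 ≤ ε) (hε : 512 * (P.d + 1) * (P.d + 4) * ε ≤ 1) :
    SchemeGaugeEquiv P.d (fun _ => step42 P.L) (fun _ => cstep P N) P.L T 1 (sfClass P.d P.L T ε 1) where
  cov₁ κ U _ _ _ := by
    rw [avgIterS_step42, avgIterS_step42, B7Prop6Flat.avgIter_gaugeAct_units, uLev_blockLift P.L P.hL.2.le 1 κ]
  cov₂ κ U hκ hκP hU := (schemeGaugeEquiv_cstep (P := P) (N := N) 1 T).cov₂ κ U hκ hκP ⟨hU.1, hU.2.1⟩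
  defect U hU := by
    obtain ⟨κ, hκ, hκP, h⟩ := (schemeGaugeEquiv_cstep (P := P) (N := N) 1 T).defect U ⟨hU.1, hU.2.1⟩
    refine ⟨κ, hκ, hκP, ?_⟩
    rw [h, avgIterS_const, avgIterS_const, Function.iterate_one, Function.iterate_one,
      gbstep_eq_step42_of_smallField hU.1 (by positivity) (smallness_one hε) hU.2.2]

/-- **★★ A DEPTH-1 `cstep`-CONSTRAINED MINIMISER IS A GAUGE TRANSFORM OF A (43)-CONSTRAINED MINIMISER AT THE SAME DATUM**: on `sfClass P.d P.L T ε` with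
`512(d+1)(d+4)ε ≤ 1`, every minimiser of the level-1 action over the `cstep`-admissible configurations of datum `V` is carried by a unitary `(T·L)`-periodic
gauge to a minimiser of the tree's (43)-constrained problem (`MinimalActionSandwich.IsMinimiser`) at the same `V`. [folklore] -/
theorem exists_isMinimiser_gaugeAct_of_isMinimiserS_cstep_one (T : ℕ) {ε : ℝ} (hε0 : 0 ≤ ε) (hε : 512 * (P.d + 1) * (P.d + 4) * ε ≤ 1)
    {V U : Site P.d → Fin P.d → (Mat N)ˣ} (hU : IsMinimiserS P.d (fun _ => cstep P N) (sfClass P.d P.L T ε) P.L T 1 V U) :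
    ∃ u : Site P.d → (Mat N)ˣ, IsUnitarySite u ∧ IsPeriodicSite u ((T * P.L ^ 1 : ℕ) : ℤ) ∧
      IsMinimiser P.d (sfClass P.d P.L T ε) P.L T 1 V (gaugeAct u U) := by
  haveI : Nonempty (Fin N) := ⟨0⟩
  obtain ⟨u, hu, huP, h⟩ := exists_isMinimiserS_gaugeAct_of_isMinimiserS (𝒞 := sfClass P.d P.L T ε) P.hL.2.le
    (fun u U hu huP hU => mem_sfClass_gaugeAct hu huP hU) (schemeGaugeEquiv_step42_cstep_one (P := P) (N := N) T hε0 hε) hU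
  exact ⟨u, hu, huP, (isMinimiserS_step42_iff P.L _ T 1 V _).1 h⟩

/-- **★★ CONVERSELY**: a depth-1 (43)-constrained minimiser is a gauge transform of a `cstep`-constrained minimiser at the same datum. [folklore] -/
theorem exists_isMinimiserS_cstep_gaugeAct_of_isMinimiser_one (T : ℕ) {ε : ℝ} (hε0 : 0 ≤ ε) (hε : 512 * (P.d + 1) * (P.d + 4) * ε ≤ 1)
    {V U : Site P.d → Fin P.d → (Mat N)ˣ} (hU : IsMinimiser P.d (sfClass P.d P.L T ε) P.L T 1 V U) :
    ∃ u : Site P.d → (Mat N)ˣ, IsUnitarySite u ∧ IsPeriodicSite u ((T * P.L ^ 1 : ℕ) : ℤ) ∧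
      IsMinimiserS P.d (fun _ => cstep P N) (sfClass P.d P.L T ε) P.L T 1 V (gaugeAct u U) := by
  haveI : Nonempty (Fin N) := ⟨0⟩
  have hU' : IsMinimiserS P.d (fun _ => step42 P.L) (sfClass P.d P.L T ε) P.L T 1 V U := (isMinimiserS_step42_iff P.L _ T 1 V U).2 hU
  exact exists_isMinimiserS_gaugeAct_of_isMinimiserS (𝒞 := sfClass P.d P.L T ε) P.hL.2.le
    (fun u U hu huP hU => mem_sfClass_gaugeAct hu huP hU) (schemeGaugeEquiv_step42_cstep_one (P := P) (N := N) T hε0 hε).symm hU'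

/-- **★ HENCE, AT DEPTH 1, THE TWO CONSTRAINED PROBLEMS HAVE MINIMISERS AT EXACTLY THE SAME DATA** (existence transfer, §1). [folklore] -/
theorem exists_isMinimiser_one_iff_cstep (T : ℕ) {ε : ℝ} (hε0 : 0 ≤ ε) (hε : 512 * (P.d + 1) * (P.d + 4) * ε ≤ 1)
    (V : Site P.d → Fin P.d → (Mat N)ˣ) :
    (∃ U, IsMinimiserS P.d (fun _ => cstep P N) (sfClass P.d P.L T ε) P.L T 1 V U) ↔ ∃ U, IsMinimiser P.d (sfClass P.d P.L T ε) P.L T 1 V U := by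
  constructor
  · rintro ⟨U, hU⟩
    obtain ⟨u, -, -, h⟩ := exists_isMinimiser_gaugeAct_of_isMinimiserS_cstep_one (P := P) (N := N) T hε0 hε hU
    exact ⟨_, h⟩
  · rintro ⟨U, hU⟩
    obtain ⟨u, -, -, h⟩ := exists_isMinimiserS_cstep_gaugeAct_of_isMinimiser_one (P := P) (N := N) T hε0 hε hU
    exact ⟨_, h⟩

end DepthOne

/-! ## §3 (v1.1) Every gauge-invariant property of constrained minimisers transfers -/

section Forall

variable {d : ℕ} {n : Type*} [Fintype n] [DecidableEq n]
variable {s s₁ s₂ : ℕ → (Site d → Fin d → (Matrix n n ℂ)ˣ) → (Site d → Fin d → (Matrix n n ℂ)ˣ)}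
  {𝒞 : ℕ → Set (Site d → Fin d → (Matrix n n ℂ)ˣ)} {L N k : ℕ}

/-- **EVERY GAUGE-INVARIANT PROPERTY OF CONSTRAINED MINIMISERS TRANSFERS BETWEEN GAUGE-EQUIVALENT SCHEMES**: if `Q` is invariant under unitary
`(N·L^k)`-periodic gauges (both directions follow from one by the inverse gauge, but both are taken as stated), then under part 14's `SchemeGaugeEquiv` on a
gauge-invariant class, `Q` holds for all `s₂`-constrained minimisers at the data of `dom` iff it holds for all `s₁`-constrained ones.  g0's `LeafH3supS`
(`Q = RegularSup`) is the instance behind part 14's `leafH3supS_iff_of_schemeGaugeEquiv`. [folklore] -/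
theorem forall_isMinimiserS_iff_of_schemeGaugeEquiv (hL : 1 ≤ L)
    (hC : ∀ (u : Site d → (Matrix n n ℂ)ˣ) (U : Site d → Fin d → (Matrix n n ℂ)ˣ), IsUnitarySite u →
      IsPeriodicSite u ((N * L ^ k : ℕ) : ℤ) → U ∈ 𝒞 k → gaugeAct u U ∈ 𝒞 k)
    (hE : SchemeGaugeEquiv d s₁ s₂ L N k (𝒞 k)) {Q : (Site d → Fin d → (Matrix n n ℂ)ˣ) → Prop}
    (hQ : ∀ (u : Site d → (Matrix n n ℂ)ˣ) (U : Site d → Fin d → (Matrix n n ℂ)ˣ), IsUnitarySite u →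
      IsPeriodicSite u ((N * L ^ k : ℕ) : ℤ) → Q (gaugeAct u U) → Q U)
    (dom : Set (Site d → Fin d → (Matrix n n ℂ)ˣ)) :
    (∀ V ∈ dom, ∀ U, IsMinimiserS d s₂ 𝒞 L N k V U → Q U) ↔ (∀ V ∈ dom, ∀ U, IsMinimiserS d s₁ 𝒞 L N k V U → Q U) := by
  constructor
  · intro h V hV U hU
    obtain ⟨u, hu, huP, hmin⟩ := exists_isMinimiserS_gaugeAct_of_isMinimiserS hL hC hE.symm hU
    exact hQ u U hu huP (h V hV _ hmin)
  · intro h V hV U hU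
    obtain ⟨u, hu, huP, hmin⟩ := exists_isMinimiserS_gaugeAct_of_isMinimiserS hL hC hE hU
    exact hQ u U hu huP (h V hV _ hmin)

/-- The same against (43) under part 12's criterion: a gauge-invariant property holds for all `s`-constrained minimisers at the data of `dom` iff it holds for all
(43)-constrained minimisers (`MinimalActionSandwich.IsMinimiser`). [folklore] -/
theorem forall_isMinimiser_iff_of_exactGaugeDefect (hL : 1 ≤ L)
    (hC : ∀ (u : Site d → (Matrix n n ℂ)ˣ) (U : Site d → Fin d → (Matrix n n ℂ)ˣ), IsUnitarySite u →
      IsPeriodicSite u ((N * L ^ k : ℕ) : ℤ) → U ∈ 𝒞 k → gaugeAct u U ∈ 𝒞 k)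
    (hE : ExactGaugeDefect d s L N k (𝒞 k)) {Q : (Site d → Fin d → (Matrix n n ℂ)ˣ) → Prop}
    (hQ : ∀ (u : Site d → (Matrix n n ℂ)ˣ) (U : Site d → Fin d → (Matrix n n ℂ)ˣ), IsUnitarySite u →
      IsPeriodicSite u ((N * L ^ k : ℕ) : ℤ) → Q (gaugeAct u U) → Q U)
    (dom : Set (Site d → Fin d → (Matrix n n ℂ)ˣ)) :
    (∀ V ∈ dom, ∀ U, IsMinimiserS d s 𝒞 L N k V U → Q U) ↔ (∀ V ∈ dom, ∀ U, IsMinimiser d 𝒞 L N k V U → Q U) := by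
  constructor
  · intro h V hV U hU
    obtain ⟨u, hu, huP, hmin⟩ := exists_isMinimiserS_gaugeAct_of_isMinimiser hL hC hE hU
    exact hQ u U hu huP (h V hV _ hmin)
  · intro h V hV U hU
    obtain ⟨u, hu, huP, hmin⟩ := exists_isMinimiser_gaugeAct_of_isMinimiserS hL hC hE hU
    exact hQ u U hu huP (h V hV _ hmin)

end Forall

end

end Summit.QuantumFields.YangMills.BalabanUVNodes.N16CentreConventionDepthOne
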